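import Summits.Ventures.Crystal3D.Theorems.StickyWulffConstantNoReconstructionGainTwoFamilyLattice
import HarnessLib

/-!
# The atom for films drawn from TWO Barlow families, at normals inside both `54.7°`-cones

HONEST FRAMING. Part of the venture `Summits/Ventures/Crystal3D` (cell `crystal3d-full`), helper
`--supports` the crux `NoReconstructionGain` (stmt-Ventures-19144, route
`route-Ventures-StickyWulffConstant`), line `adhesion`; continuation of `…BasalBarlowFilm` (one
family) and `…TwoFamilyLattice` (the per-ball count at lattice balls).

* `noGainIneq_of_isometry` — the per-ball inequality (T2) is invariant under a linear isometry of
  the whole configuration (bookkeeping);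
* `twoFamilyBarlowFilm_adhesion` (**the rung**, `R = 1`, `C = 0`; registered by name): for every unit
  `ν` with `ν₃² > 1/3` AND `(R_t ν)₃² > 1/3` (`R_t` the half-turn about the bond `t`, so `R_t e₃` is the
  axis `(u+v+t)/√6` of a second `{111}` family), every `ρ ≥ 1`, every finite unit packing `X ⊇ P`
  around the `ν`-slab sample whose film balls are Barlow positions of EITHER family —
  `Λ₀ ∪ (Λ₀ ± w) ∪ (Λ₀ ± w')`, `w' = (2/3)t − w = R_t w` — and lie above the cut:
  `#cross(P, X \ P) ≤ contactDeficiency (X \ P)`.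

So grains, twins and faults of two different `{111}` families may coexist in the film (they meet only
through lattice balls: `crossCoset_dist_ne_one`), at every normal in the lens where both families'
polar directions split cleanly by `ν`-sign (e.g. all normals near `t` itself, a `(110)`-type pole).
Proof: `cross_le_of_potential` with the `ν`-height rank; lattice balls by
`twoFamily_lattice_noGainPotential`, basal coset balls by `basal_noGainPotential` (their partners are
basal), `w'`-coset balls by `basal_noGainPotential` transported through `R_t`.

WHAT THIS IS NOT: three or four families (the tri-cone is empty anyway), normals outside the lens,
films below the cut; rung F-C1 not moved.
-/

noncomputable section

namespace Summit.Ventures.Crystal3D.Theorems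

open Summit.Ventures.Crystal3D Finset
open Literature.MathematicalPhysics.StatisticalMechanics (barlowPos barlowStacking fccStacking
  barlowOffset constHagg haggLabel_const barlowPos_apply_zero barlowPos_apply_one barlowPos_apply_two
  orderedContacts contactDeficiency)
open scoped InnerProductSpace

/-! ### Transport of the per-ball inequality -/

/-- **(T2) is invariant under a linear isometry of the configuration.** -/
theorem noGainIneq_of_isometry
    (g : EuclideanSpace ℝ (Fin 3) ≃ₗᵢ[ℝ] EuclideanSpace ℝ (Fin 3))
    (X P : Finset (EuclideanSpace ℝ (Fin 3))) (q : EuclideanSpace ℝ (Fin 3))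
    (Φ : EuclideanSpace ℝ (Fin 3) → ℤ)
    (h : ((((X.image g) \ (P.image g)).filter fun y =>
            dist (g q) y = 1 ∧ Φ (g.symm y) < Φ (g.symm (g q))).card : ℤ)
        + (((P.image g).filter fun p => dist (g q) p = 1).card : ℤ)
      ≤ (12 - (((X.image g).filter fun y => dist (g q) y = 1).card : ℤ))
        + ((((X.image g) \ (P.image g)).filter fun y =>
            dist (g q) y = 1 ∧ Φ (g.symm (g q)) < Φ (g.symm y)).card : ℤ)) :
    (((X \ P).filter fun x => dist q x = 1 ∧ Φ x < Φ q).card : ℤ)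
        + ((P.filter fun p => dist q p = 1).card : ℤ)
      ≤ (12 - ((X.filter fun x => dist q x = 1).card : ℤ))
        + (((X \ P).filter fun x => dist q x = 1 ∧ Φ q < Φ x).card : ℤ) := by
  classical
  have hinj : Function.Injective g := g.injective
  have hsd : X.image g \ P.image g = (X \ P).image g := (image_sdiff X P hinj).symm
  have key : ∀ (s : Finset (EuclideanSpace ℝ (Fin 3))) (p : EuclideanSpace ℝ (Fin 3) → Prop)
      [DecidablePred p], ((s.image g).filter p).card = (s.filter fun x => p (g x)).card := by
    intro s p _
    rw [filter_image, card_image_of_injective _ hinj]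
  rw [hsd, key, key, key, key] at h
  have e1 : ((X \ P).filter fun x => dist (g q) (g x) = 1 ∧ Φ (g.symm (g x)) < Φ (g.symm (g q))) =
      ((X \ P).filter fun x => dist q x = 1 ∧ Φ x < Φ q) := by
    refine filter_congr fun x _ => ?_
    rw [g.dist_map, g.symm_apply_apply, g.symm_apply_apply]
  have e2 : (P.filter fun x => dist (g q) (g x) = 1) = (P.filter fun p => dist q p = 1) := by
    refine filter_congr fun x _ => ?_
    rw [g.dist_map]
  have e3 : (X.filter fun x => dist (g q) (g x) = 1) = (X.filter fun x => dist q x = 1) := by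
    refine filter_congr fun x _ => ?_
    rw [g.dist_map]
  have e4 : ((X \ P).filter fun x => dist (g q) (g x) = 1 ∧ Φ (g.symm (g q)) < Φ (g.symm (g x))) =
      ((X \ P).filter fun x => dist q x = 1 ∧ Φ q < Φ x) := by
    refine filter_congr fun x _ => ?_
    rw [g.dist_map, g.symm_apply_apply, g.symm_apply_apply]
  rw [e1, e2, e3, e4] at h
  exact h

/-! ### The rung -/

/-- **The atom for two-family Barlow films at normals inside both cones** (`R = 1`, `C = 0`;
registered by name on stmt-Ventures-19144).  Hypotheses after the slab clause: `ν₃² > 1/3`;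
`(2⟪ν,t⟫√(2/3) − ν₃)² > 1/3` (the third coordinate of `R_t ν`); every film ball lies in
`Λ₀ ∪ (Λ₀ ± w) ∪ (Λ₀ ± ((2/3)t − w))`; every film ball lies above the cut. -/
theorem twoFamilyBarlowFilm_adhesion :
    ∃ R C : ℝ, 1 ≤ R ∧ ∀ ν : EuclideanSpace ℝ (Fin 3), ‖ν‖ = 1 → ∀ ρ : ℝ, R ≤ ρ →
      ∀ X P : Finset (EuclideanSpace ℝ (Fin 3)),
      (∀ p ∈ X, ∀ q ∈ X, p ≠ q → 1 ≤ dist p q) → P ⊆ X →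
      (∀ p, p ∈ P ↔ (p ∈ fccStacking 1 (Real.sqrt (2 / 3)) ∧ -(2 * R) ≤ ⟪p, ν⟫_ℝ ∧
        ⟪p, ν⟫_ℝ ≤ -R ∧ ‖p‖ ^ 2 - ⟪p, ν⟫_ℝ ^ 2 ≤ ρ ^ 2)) →
      1 / 3 < ν 2 ^ 2 →
      1 / 3 < (2 * ⟪ν, barlowPos 1 (Real.sqrt (2 / 3)) constHagg 1 0 0⟫_ℝ * Real.sqrt (2 / 3) - ν 2) ^ 2 →
      (∀ q ∈ X \ P, q ∈ fccStacking 1 (Real.sqrt (2 / 3)) ∨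
        q - barlowOffset 1 ∈ fccStacking 1 (Real.sqrt (2 / 3)) ∨
        q + barlowOffset 1 ∈ fccStacking 1 (Real.sqrt (2 / 3)) ∨
        q - ((2 / 3 : ℝ) • barlowPos 1 (Real.sqrt (2 / 3)) constHagg 1 0 0 - barlowOffset 1) ∈
          fccStacking 1 (Real.sqrt (2 / 3)) ∨
        q + ((2 / 3 : ℝ) • barlowPos 1 (Real.sqrt (2 / 3)) constHagg 1 0 0 - barlowOffset 1) ∈
          fccStacking 1 (Real.sqrt (2 / 3))) →
      (∀ q ∈ X \ P, -R < ⟪q, ν⟫_ℝ) →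
      ((((P ×ˢ (X \ P)).filter fun pq => dist pq.1 pq.2 = 1).card : ℕ) : ℝ) ≤
        contactDeficiency (X \ P) + C * ρ := by
  classical
  refine ⟨1, 0, le_rfl, fun ν hν ρ hρ X P hX hPX hP hν3 hν3R hfilm habove => ?_⟩
  rw [zero_mul, add_zero]
  obtain ⟨Rt, hRt⟩ := exists_halfTurn_t
  -- names (opaque) for the two letter offsets
  obtain ⟨w, hw⟩ : ∃ w : EuclideanSpace ℝ (Fin 3), w = barlowOffset 1 := ⟨_, rfl⟩
  obtain ⟨w', hw'⟩ : ∃ w' : EuclideanSpace ℝ (Fin 3),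
      w' = (2 / 3 : ℝ) • barlowPos 1 (Real.sqrt (2 / 3)) constHagg 1 0 0 - barlowOffset 1 := ⟨_, rfl⟩
  rw [← hw', ← hw] at hfilm
  have hRw : Rt w = w' := by rw [hw, hw', halfTurn_barlowOffset Rt hRt]
  have hRR : ∀ x, Rt (Rt x) = x := halfTurn_halfTurn Rt hRt
  have hRw' : Rt w' = w := by rw [← hRw, hRR]
  have hRmem : ∀ p, p ∈ fccStacking 1 (Real.sqrt (2 / 3)) → Rt p ∈ fccStacking 1 (Real.sqrt (2 / 3)) :=
    fun p hp => halfTurn_mem Rt hRt hp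
  have hν3' : 1 / 3 < (Rt ν) 2 ^ 2 := by rw [halfTurn_apply_two Rt hRt]; exact hν3R
  -- every ball of `X` is in one of the five classes
  have hB : ∀ y ∈ X, y ∈ fccStacking 1 (Real.sqrt (2 / 3)) ∨
      y - w ∈ fccStacking 1 (Real.sqrt (2 / 3)) ∨ y + w ∈ fccStacking 1 (Real.sqrt (2 / 3)) ∨
      y - w' ∈ fccStacking 1 (Real.sqrt (2 / 3)) ∨ y + w' ∈ fccStacking 1 (Real.sqrt (2 / 3)) := by
    intro y hy
    by_cases hyP : y ∈ P
    · exact Or.inl ((hP y).1 hyP).1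
    · exact hfilm y (mem_sdiff.2 ⟨hy, hyP⟩)
  -- no contact between a `w`-coset ball and a `w'`-coset ball
  have hcross : ∀ a b : EuclideanSpace ℝ (Fin 3),
      (a - w ∈ fccStacking 1 (Real.sqrt (2 / 3)) ∨ a + w ∈ fccStacking 1 (Real.sqrt (2 / 3))) →
      (b - w' ∈ fccStacking 1 (Real.sqrt (2 / 3)) ∨ b + w' ∈ fccStacking 1 (Real.sqrt (2 / 3))) →
      dist a b ≠ 1 := by
    intro a b ha hb
    rw [hw] at ha; rw [hw'] at hb
    exact crossCoset_dist_ne_one ha hb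
  set f : EuclideanSpace ℝ (Fin 3) → ℝ := fun y => ⟪y, ν⟫_ℝ with hf
  set Φ : EuclideanSpace ℝ (Fin 3) → ℤ := fun x => (((X \ P).filter fun y => f y < f x).card : ℤ) with hΦ
  have hmain := cross_le_of_potential X P ∅ hX hPX (empty_subset _) Φ fun q hq => by
    rw [sdiff_empty] at hq
    have hqX : q ∈ X := (mem_sdiff.1 hq).1
    have hlt : ∀ x ∈ X \ P, dist q x = 1 → (Φ x < Φ q ↔ ⟪x, ν⟫_ℝ < ⟪q, ν⟫_ℝ) := fun x hx _ => by
      simp only [hΦ]; exact rank_lt_iff (X \ P) f x q hx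
    have heq : ∀ x ∈ X \ P, dist q x = 1 → (Φ x = Φ q ↔ ⟪x, ν⟫_ℝ = ⟪q, ν⟫_ℝ) := fun x hx _ => by
      simp only [hΦ]; exact rank_eq_iff (X \ P) f x q hx hq
    have hplug : ∀ p ∈ P, dist q p = 1 → ⟪p, ν⟫_ℝ < ⟪q, ν⟫_ℝ := by
      intro p hp _
      obtain ⟨_, _, hp2, _⟩ := (hP p).1 hp
      exact lt_of_le_of_lt hp2 (habove q hq)
    have h3 : q ∈ fccStacking 1 (Real.sqrt (2 / 3)) ∨
        (q - w ∈ fccStacking 1 (Real.sqrt (2 / 3)) ∨ q + w ∈ fccStacking 1 (Real.sqrt (2 / 3))) ∨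
        (q - w' ∈ fccStacking 1 (Real.sqrt (2 / 3)) ∨ q + w' ∈ fccStacking 1 (Real.sqrt (2 / 3))) := by
      rcases hB q hqX with h | h | h | h | h
      exacts [Or.inl h, Or.inr (Or.inl (Or.inl h)), Or.inr (Or.inl (Or.inr h)),
        Or.inr (Or.inr (Or.inl h)), Or.inr (Or.inr (Or.inr h))]
    rcases h3 with hqΛ | hqa | hqb
    · -- a lattice ball: the two-family count
      refine twoFamily_lattice_noGainPotential X P hX hPX q Φ ν hν hν3 Rt hRt hν3' hlt heq hplug
        fun x hx hd => ?_
      rw [← hw]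
      rcases hB x hx with h | h | h | h | h
      · exact Or.inl (fcc_sub_site_mem h hqΛ)
      · refine Or.inr (Or.inl ?_)
        have := fcc_sub_site_mem h hqΛ; rwa [show x - w - q = x - q - w by abel] at this
      · refine Or.inr (Or.inr (Or.inl ?_))
        have := fcc_sub_site_mem h hqΛ; rwa [show x + w - q = x - q + w by abel] at this
      · refine Or.inr (Or.inr (Or.inr (Or.inl ?_)))
        have := hRmem _ (fcc_sub_site_mem h hqΛ)
        rwa [map_sub, map_sub, hRw', show Rt x - w - Rt q = Rt x - Rt q - w by abel, ← map_sub] at this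
      · refine Or.inr (Or.inr (Or.inr (Or.inr ?_)))
        have := hRmem _ (fcc_sub_site_mem h hqΛ)
        rwa [map_sub, map_add, hRw', show Rt x + w - Rt q = Rt x - Rt q + w by abel, ← map_sub] at this
    · -- a ball of a basal coset: all its partners are basal Barlow positions
      have hqB : q ∈ fccStacking 1 (Real.sqrt (2 / 3)) ∨ q - barlowOffset 1 ∈ fccStacking 1 (Real.sqrt (2 / 3)) ∨
          q + barlowOffset 1 ∈ fccStacking 1 (Real.sqrt (2 / 3)) := by rw [← hw]; exact Or.inr hqa
      refine basal_noGainPotential X P hX hPX q Φ ν hν hν3 hlt heq hplug fun x hx hd => ?_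
      refine basal_unit_height hqB ?_ hd
      rw [← hw]
      rcases hB x hx with h | h | h | h | h
      · exact Or.inl h
      · exact Or.inr (Or.inl h)
      · exact Or.inr (Or.inr h)
      · exact absurd hd (hcross q x hqa (Or.inl h))
      · exact absurd hd (hcross q x hqa (Or.inr h))
    · -- a ball of a `w'`-coset: transport through the half-turn and use the basal count
      have hgi : Isometry (Rt : EuclideanSpace ℝ (Fin 3) → EuclideanSpace ℝ (Fin 3)) := Rt.isometry
      refine noGainIneq_of_isometry Rt X P q Φ ?_
      have hXp : ∀ p ∈ X.image Rt, ∀ q ∈ X.image Rt, p ≠ q → 1 ≤ dist p q := by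
        intro p hp q' hq' hpq
        obtain ⟨p₀, hp₀, rfl⟩ := mem_image.1 hp
        obtain ⟨q₀, hq₀, rfl⟩ := mem_image.1 hq'
        rw [hgi.dist_eq]
        exact hX p₀ hp₀ q₀ hq₀ fun e => hpq (by rw [e])
      have hsd : X.image Rt \ P.image Rt = (X \ P).image Rt := (image_sdiff X P Rt.injective).symm
      have hqB : Rt q ∈ fccStacking 1 (Real.sqrt (2 / 3)) ∨
          Rt q - barlowOffset 1 ∈ fccStacking 1 (Real.sqrt (2 / 3)) ∨
          Rt q + barlowOffset 1 ∈ fccStacking 1 (Real.sqrt (2 / 3)) := by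
        rw [← hw]
        rcases hqb with h | h
        · refine Or.inr (Or.inl ?_); have := hRmem _ h; rwa [map_sub, hRw'] at this
        · refine Or.inr (Or.inr ?_); have := hRmem _ h; rwa [map_add, hRw'] at this
      refine basal_noGainPotential (X.image Rt) (P.image Rt) hXp (image_subset_image hPX) (Rt q)
        (fun y => Φ (Rt.symm y)) (Rt ν) (by rw [LinearIsometryEquiv.norm_map, hν]) hν3'
        (fun y hy hd => ?_) (fun y hy hd => ?_) (fun p hp hd => ?_) (fun y hy hd => ?_)
      · rw [hsd] at hy
        obtain ⟨x, hx, rfl⟩ := mem_image.1 hy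
        rw [Rt.symm_apply_apply, Rt.symm_apply_apply, LinearIsometryEquiv.inner_map_map,
          LinearIsometryEquiv.inner_map_map]
        exact hlt x hx (by rw [← Rt.dist_map]; exact hd)
      · rw [hsd] at hy
        obtain ⟨x, hx, rfl⟩ := mem_image.1 hy
        rw [Rt.symm_apply_apply, Rt.symm_apply_apply, LinearIsometryEquiv.inner_map_map,
          LinearIsometryEquiv.inner_map_map]
        exact heq x hx (by rw [← Rt.dist_map]; exact hd)
      · obtain ⟨p₀, hp₀, rfl⟩ := mem_image.1 hp
        rw [LinearIsometryEquiv.inner_map_map, LinearIsometryEquiv.inner_map_map]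
        exact hplug p₀ hp₀ (by rw [← Rt.dist_map]; exact hd)
      · obtain ⟨x, hx, rfl⟩ := mem_image.1 hy
        have hd' : dist q x = 1 := by rw [← Rt.dist_map]; exact hd
        refine basal_unit_height hqB ?_ hd
        rw [← hw]
        rcases hB x hx with h | h | h | h | h
        · exact Or.inl (hRmem _ h)
        · exact absurd (by rw [dist_comm]; exact hd') (hcross x q (Or.inl h) hqb)
        · exact absurd (by rw [dist_comm]; exact hd') (hcross x q (Or.inr h) hqb)
        · refine Or.inr (Or.inl ?_); have := hRmem _ h; rwa [map_sub, hRw'] at this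
        · refine Or.inr (Or.inr ?_); have := hRmem _ h; rwa [map_add, hRw'] at this
  simpa using hmain

end Summit.Ventures.Crystal3D.Theorems

end
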